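import Mathlib
import Literature.Analysis.FluidPDE.NSWave0
import Literature.Analysis.FluidPDE.ClassicalSolution
import Literature.Analysis.FluidPDE.LerayHopf
import Literature.Analysis.FluidPDE.AxisymmetricEuler
import Literature.Analysis.PDE.NewtonianKernel
import HarnessLib

/-!
# Claim skeleton (D-0090 NS-CLAIMS, C11): Shahmurov, arXiv:2605.09797 v2 — "two-part first-threshold" global smoothness

Typed skeleton of R. Shahmurov, *A Classical Two-Part First-Threshold Proof of Global Smoothness for
Navier–Stokes: Axisymmetric Swirl Closure and Full-System Reduction*, arXiv:2605.09797, **v2 of 2026-05-15**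
(text of record, lead ruling 2026-08-26T16:10Z; bib `Shahmurov2026TwoPart`; 43 pp.; locators `p.N` = PDF page
of v2, `l.N` = line of the v2 TeX source materialised by ns-claims-lit-2 in
`pub/ns-claims/sources/Shahmurov2026/toplevel-arxiv-2605.09797/`). UNREFEREED CLAIM under adjudication —
NOTHING in this file asserts a step of the paper: the paper's statements are `def … : Prop`; the `theorem`s
are kernel-checked RELATIONS between them (the paper's own elementary algebra and calculus) and the composition.
Verdict vocabulary is the refuter's / referee's (cell ns-claims: refuter-4, ref-3).

Cluster context (CARD §1): v1 (2026-05-10) has the same §5; the same strictness step is D-I = arXiv:2605.01875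
v3 Thm 3.14/3.17 and AX = arXiv:2606.07869 v1 Thm 32.3/27.5; the full-system front end reappears as D-II =
arXiv:2605.01873 v2 Thm 4.7/4.8 and RED = arXiv:2606.07875 v1 Thm 11.2 (RED l.211 positions T as the author's
earlier route; the June chain RED + AX is the cell's sub-row C11b, not typed here).

## The claimed statements (p.3)

* **Main Theorem 1.1** (l.127, p.3) "Let `u₀ ∈ C_c^∞(ℝ³)` be divergence-free, axisymmetric, and of finite
  energy. Let `u` be the corresponding smooth axisymmetric Navier–Stokes solution on its maximal smooth interval
  `[0,T_*)`. Then `T_* = ∞`." — `ClaimedTheoremAxisym`.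
* **Main Theorem 1.2** (l.132, p.3; = Main Theorem 11.1, l.1325, p.24) the same without axisymmetry —
  `ClaimedTheorem`. Equations (1.1) l.88: `∂ₜu + u·∇u + ∇p = Δu`, `∇·u = 0` on `ℝ³`: `ν = 1`, `f ≡ 0`.
  Typed in the tree's continuation vocabulary (`IsClassicalNSSolutionOn`, `HasSmoothExtensionPast`; the
  "corresponding smooth finite-energy solution" is marked by `IsLerayHopfOn`, as in the tree's `NoBlowup`).

Clay delta (reference `Literature.Claims.NS.ClayVariants`, (A) = `clayR3.Regularity`): Δ1 domain `ℝ³` =;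
Δ3 force `f ≡ 0` =; **Δ4 data `C_c^∞ ⊊ (4)`** (compact support is a SMALLER class than rapid decay: as
printed the statement covers LESS data than (A); `ClaySpec.RegularityAt.mono` would need
`HasRapidSpatialDecay u₀ → HasCompactSupport u₀`, false) — so `ClaimedTheorem → clayR3.RegularityAt 1` is NOT
derivable and is not stated; Δ6 conclusion in continuation form "`T_* = ∞`" (equivalent to the `[0,∞)` form
for Clay data given uniqueness + energy inequality — summit-side `navierStokesRegularity_iff_noBlowup`;
recorded, not convicted on); Δ7 `ν = 1` (EQUIVALENT for (A): `ClayVariants.clayR3_regularityAt_iff`).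
Main Thm 1.1 is the `C_c^∞`/`ν = 1`/continuation variant of the tree's open conjecture leaf
`Summit.NavierStokesRegularity.NavierStokesRegularity.AxisymmetricSwirlRegularity` (hard core
"axisymmetric with swirl", `Summits/NavierStokesRegularity/HardCores.lean`).

## Part I (axisymmetric closure, pp.7–23): the logic and the typed steps

The proof of Main Thm 1.1 is by contradiction from a "first-threshold terminal packet" (Def 2.2 p.9):
Prop 9.1 (p.23: `T_* < ∞` ⇒ a first-threshold packet exists, via the continuation criterion Prop 7.5 p.20)
against Prop 6.2 (p.18: no first-threshold packet exists), the latter assembled from the coefficient-one pair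
balance Prop 3.3 (p.12) `𝔸_χ ≤ 𝕁_χ + C𝔼_dir + C𝔹_end`, the soft bridge Lemma 4.1 / Cor 4.2 (p.13, subcritical
packets), the endpoint/descendant bookkeeping Lemma 6.1 (p.17), Lemma 5.7 / Cor 5.8 (p.16–17), Prop 8.4
(p.22), and the DECISIVE **Theorem 5.4 "Terminal strict pair bridge"** (p.15): `|𝕁_χ| ≤ θ_*𝔸_χ + C𝔼_dir +
C𝔹_end` with `θ_* < 1` on every compact-critical terminal cylinder. The author himself places the whole weight
here: §1.6 p.5–6 ("If the best coefficient were merely `θ = 1`, the inequality would reduce to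
`𝔸_χ ≤ 𝔸_χ + errors`, which gives no contradiction"), App. B Thm B.2 p.40 / Cor B.3 p.41 (norm-only
estimates cannot give `θ < 1`). Thm 5.4 is proved (p.15) by contradiction: a saturating normalised sequence has
a strong "endpoint profile" `(g,h)` with `𝔸[g,h] = 1`, `𝕁[g,h] = Λ_* > 0` (**Prop 5.1**, p.14), for which
**Prop 5.2** (p.14–15) asserts the "gauge-free amplitude identities" (17) `3J₁ − αJ₂ = 2Λ_*V`,
(18) `−αJ₂ = Λ_*βW`, hence (19) `3𝕁 = 2Λ_*𝔸`, and **Prop 5.3** (p.15) the "zero-error localized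
Pohozaev–Morawetz identity" (20) `(3/2)𝕁 = 2Λ_*𝔸`; then `3𝕁 = (3/2)𝕁`, `𝕁 = 0`, contradiction (Thm 5.4
proof, p.15). The proofs of Prop 5.2 / 5.3 use ONLY the homogeneity degrees of the four functionals under the
amplitude curves `g ↦ ag`, `h ↦ bh` and the mass-preserving dilation `g_s(Y) = s^{5/2}g(sY)` in the lifted
`ℝ⁵` (l.787–797, l.818–839) plus two stationarity sentences: "after normalizing `𝔸[g,h] = 1`, the profile is
stationary for `𝕁 − Λ_*𝔸` under admissible compactly supported variations and under the amplitude curves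
below" (l.783–787, p.15) and "Passing to the strong limit therefore gives exact stationarity of `𝕁 − Λ_*𝔸`
along the dilation curve" (l.844, p.15). Accordingly (cell FAILURE-MODES F15/F16, referee ref-3 and refuter-4
typing notes of 2026-08-26T16:53Z/17:27Z):

* `PairClass` — the ABSTRACT pair class: carriers, the functionals `J₁, J₂, V, W`, the fixed `α, β > 0` of
  Prop 3.3, the amplitude actions and the PRINTED amplitude scaling laws (l.787–797) as fields; `PairClass.A`,
  `PairClass.J` = `𝔸 = V + βW`, `𝕁 = J₁ − αJ₂` (l.697–698); `PairClass.Dilation` — a dilation action with the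
  PRINTED dilation laws (l.824–839) as fields. `liftedPairClass` — the paper's CONCRETE functionals on the
  lifted space `ℝ⁵ = ℝ⁴_y × ℝ_z` (l.702–709: `V[g] = ∫χ²|∇₅g|² + ∫|∇₅χ|²g²`, `J₁[g] = ∫χ²g²U[g]`,
  `J₂[g,h] = ∫χ²U[g]h²`, `U[g] = −∂_z(−Δ₅)⁻¹g` (2.5) = convolution with `∂_z` of the Newtonian kernel) IS a
  `PairClass`: the amplitude laws are PROVED (`visibility_constMul`, `transferG_constMul`, …). No
  `Dilation` structure is built for it: with the FIXED cutoff `χ` of l.702–705 the printed law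
  `V[g_s] = s²V[g]` holds only for the `χ`-free parts — the paper assigns the cutoff commutators to
  `𝔼_dir + 𝔹_end` (l.840–844) — so the dilation laws are kept abstract, exactly as printed.
* `Prop52` (Step I-5.2, p.14–15), `Prop53` (Step I-5.3, p.15): the printed statements over the abstract class,
  hypothesis = Prop 5.1's conclusion "`𝔸 = 1 ∧ 𝕁 = Λ_* ∧ 0 < Λ_*`" ("suppose it saturates the endpoint quotient
  `Λ_* = 𝕁/𝔸`"), conclusion = the equalities (17) ∧ (18), resp. (20); `prop52_total` = (19).
  `Prop52Stationarity`, `Prop53Stationarity` («implicit», the two quoted sentences) are the premises the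
  printed proofs actually use, and `prop52_of_stationarity`, `prop53_of_stationarity` ARE the printed proofs
  (differentiate the homogeneous polynomials at `a = b = s = 1`), kernel-checked. `noSaturatingProfile_of_prop52`
  and `thm54_algebra` record the F16 shape: (17) ∧ (18) (or (19), or (20)) together with `𝕁 = Λ_*𝔸`,
  `𝔸 = 1` force `Λ_* = 0` — i.e. Prop 5.2 as printed holds iff its hypothesis class is empty, and Prop 5.3 is
  not needed for Thm 5.4.
* `TerminalBookkeeping` — the Part I bookkeeping the paper attaches to smooth axisymmetric solutions (terminal
  cylinders Defs 2.2–2.3 p.9, canonical first threshold Def 8.1 p.21, `𝔸_χ, 𝕁_χ, 𝔼_dir` (§2.2 p.7, §7.1 table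
  p.20–21: "not a single estimate hidden under one name. It is the sum of the lower-order channels …"),
  `𝔹_end` / `𝓑₀`): these objects are introduced in PROSE and by displayed integrals on cylinders selected by a
  canonical order that is itself prose ("earlier endpoint time ≺ smaller active scale ≺ fewer separated active
  components ≺ more localized residual channel", Def 8.1); they are carried as an explicit parameter
  structure `K` (opaque carrier for pure bookkeeping, cell convention 3), with the calibration `α, β` and the
  cutoff `χ`. `StrictBridge K` = Thm 5.4 as printed. `Step_I51 K` (Prop 5.1 p.14 + Thm 5.4 proof, first two
  sentences, p.15): failure of the strict bridge ⇒ an endpoint profile in the CONCRETE lifted class with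
  `𝔸 = 1`, `𝕁 = Λ_* > 0` (`SO(4)`-radial, `h ≥ 0`). `Step_I62 K` (Props 3.3, 4.1–4.2, Cor 5.5, Lemma 5.7,
  Cor 5.8, Lemma 6.1, Prop 6.2, Lemma 8.2–8.3, Prop 8.4; pp.12–13, 16–18, 21–22): strict bridge ⇒ no
  first-threshold packet. `Step_I91 K` (Lemmas 7.1–7.4, Prop 7.5 p.18–20; Prop 9.1 and the proof of Main
  Thm 1.1, p.23): no first-threshold packet ⇒ Main Thm 1.1. `strictBridge_of_steps`: Step_I51 ∧ Prop52 ⇒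
  StrictBridge (the paper's Thm 5.4, WITHOUT Prop 5.3); `claimedTheoremAxisym_of_steps`.

## Part II (full-system front end, pp.24–34)

Main Thm 11.1 proof (p.24) / §20 (p.33–34): `T_* < ∞` ⇒ CKN contrapositive Lemma 13.1 (p.26) ⇒ canonically
minimal packet Prop 14.1 (p.27) ⇒ positive final defect gives loss or descendant, Thm 19.1 (p.33), excluded by
the terminal balance Lemma 14.2 (p.27) and minimality ⇒ zero final defect ⇒ **Thm 18.4 zero-defect rigidity**
(p.32; Lemmas 17.4 p.30, 18.1–18.3 p.31–32): "every terminal limit is either locally two-dimensional or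
axisymmetric with swirl around one fixed axis" ⇒ "The locally two-dimensional alternative is regular by the
classical two-dimensional Navier–Stokes theory … The axisymmetric alternative is regular by Theorem 1.1"
(l.1337, p.24; l.1870, p.34; §21 p.34: "The only handoff from Part II to Part I is the exact
axisymmetric-with-swirl class obtained in Lemma 18.3"). The Part II objects — defect channels Def 15.1–15.2
p.28 (`𝔇_frag` := "minimum fraction of active score outside the largest coherent component", `𝔇_pass` :=
"fraction of terminal stretching produced by passive strain on the active core", `𝔇_phase` := "loss in the
finite-dimensional phase-lock coefficient relative to its maximum"), the active frame measure Def 17.2 p.30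
("Each piece with nonzero transfer is assigned its dominant frame"), the rigid families Def 17.3 — have no
displayed mathematical definition, so Part II is typed at the grain of its INTERFACE, over concrete objects:
`packetVelocity`/`packetPressure` (Def 12.1 p.25), `cknSize` (Def 12.3 p.25), `IsTerminalLimit` (typist's
reading, flagged: the print never names the topology of "terminal limit"; typed as STRONG `L³` convergence of
rotated normalised packets on `Q₂ = (−4,0] × B₂`, the reading most favourable to the handoff),
`IsLocallyTwoDimensional` (dictionary p.24–25, junk-free translation form), `IsAxisymmetricBranch`.
`Step_II_frontEnd` (Lemma 13.1 … Thm 19.1, pp.26–33): a singular run has a terminal limit that is locally 2D or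
axisymmetric. `Step_II_twoD` («implicit», Lemma 18.2 last sentence p.31, l.1337 p.24): no terminal limit of a
singular run is locally 2D. `Step_II_handoff` («implicit», l.1337 p.24, l.1870 p.34, l.1893 p.34): Main Thm 1.1
⇒ no terminal limit of a singular run is axisymmetric — Main Thm 1.1 speaks of solutions from `C_c^∞`
axisymmetric DATA on `[0,T_*)`, the terminal limit is a normalised blow-up limit on a unit cylinder; the
implication between them is not printed and is typed as its own step.

COMPOSITION: proved as `claim_of_steps` —
`Step_I51 K → Prop52 → Prop53 → Step_I62 K → Step_I91 K → Step_II_frontEnd → Step_II_twoD → Step_II_handoff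
→ ClaimedTheorem` for any bookkeeping `K` (pure logic; `Prop53` is on the printed path but not consumed).

WHAT THIS IS NOT: not a claim about NS regularity or blow-up; not a claim about any author beyond the typed
locator.
-/

open scoped ENNReal Topology
open _root_.MeasureTheory _root_.Set _root_.Filter

namespace Literature.Claims.NS.Shahmurov2026

open Literature.Analysis.FluidPDE

noncomputable section

/-- Physical space `ℝ³`. [folklore] -/
abbrev E3 : Type := EuclideanSpace ℝ (Fin 3)

/-- The lifted space `ℝ⁵ = ℝ⁴_y × ℝ_z` of §2 (p.7–10, l.109–117, l.410–425): an axisymmetric scalar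
`f(r,z)` is represented by `f̃(y,z) = f(|y|,z)`, `y ∈ ℝ⁴`; coordinates `0,…,3` are `y`, coordinate `4` is `z`.
[cite: Shahmurov2026TwoPart, §2 p.7–10] -/
abbrev E5 : Type := EuclideanSpace ℝ (Fin 5)

/-! ## A. The claimed statements (Main Theorems 1.1, 1.2 = 11.1), in the author's setting -/

/-- **Main Theorem 1.1** (l.127, p.3; proof p.23) "Global axisymmetric continuation": for `u₀ ∈ C_c^∞(ℝ³)`
divergence-free, axisymmetric, of finite energy, the corresponding smooth axisymmetric Navier–Stokes solution
(`ν = 1`, `f ≡ 0`, eq. (1.1) l.88) has maximal smooth interval `[0,∞)`. Continuation form: every smooth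
finite-energy (Leray–Hopf-class) axisymmetric solution on `[0,T)` with datum `u₀` extends smoothly past `T`.
(Finite energy is implied by `C_c^∞`.) [claim: Shahmurov2026TwoPart, status: under-review] -/
def ClaimedTheoremAxisym : Prop :=
  ∀ u₀ : E3 → E3, ContDiff ℝ (⊤ : ℕ∞) u₀ → HasCompactSupport u₀ → NSWave0.IsDivFree u₀ →
    IsAxisymmetric u₀ →
    ∀ T : ℝ, 0 < T → ∀ (u : ℝ → E3 → E3) (p : ℝ → E3 → ℝ),
      IsClassicalNSSolutionOn (Ico 0 T) 1 0 u p → u 0 = u₀ → IsLerayHopfOn T 1 0 u₀ u →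
      (∀ t ∈ Ico 0 T, IsAxisymmetric (u t)) →
      HasSmoothExtensionPast 1 0 u T

/-- **Main Theorem 1.2** (l.132, p.3) = **Main Theorem 11.1** (l.1325, p.24) "Full three-dimensional
continuation": for `u₀ ∈ C_c^∞(ℝ³)` divergence-free of finite energy, the corresponding smooth Navier–Stokes
solution (`ν = 1`, `f ≡ 0`) has `T_* = ∞`. Continuation form as in `ClaimedTheoremAxisym`. This is the
claim's headline; Clay delta Δ4 (`C_c^∞` data only), Δ7 (`ν = 1`), see the module docstring.
[claim: Shahmurov2026TwoPart, status: under-review] -/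
def ClaimedTheorem : Prop :=
  ∀ u₀ : E3 → E3, ContDiff ℝ (⊤ : ℕ∞) u₀ → HasCompactSupport u₀ → NSWave0.IsDivFree u₀ →
    ∀ T : ℝ, 0 < T → ∀ (u : ℝ → E3 → E3) (p : ℝ → E3 → ℝ),
      IsClassicalNSSolutionOn (Ico 0 T) 1 0 u p → u 0 = u₀ → IsLerayHopfOn T 1 0 u₀ u →
      HasSmoothExtensionPast 1 0 u T

/-- Main Thm 1.2 contains Main Thm 1.1 (pure logic: drop the symmetry hypotheses; p.3: "Theorem 1.2 is
obtained by combining the Part I theorem with the Part II front-end reduction").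
[cite: Shahmurov2026TwoPart, Main Theorems 1.1–1.2 p.3] -/
theorem claimedTheoremAxisym_of_claimedTheorem (h : ClaimedTheorem) : ClaimedTheoremAxisym :=
  fun u₀ hu₀ hcs hdiv _ T hT u p hsol h0 hLH _ => h u₀ hu₀ hcs hdiv T hT u p hsol h0 hLH

/-! ## B. §5 (p.14–15): the endpoint pair-quotient algebra, typed over an abstract pair class -/

/-- **The abstract pair class of §5** (p.14, l.695–711 with the amplitude scaling laws of l.787–797): two
carriers (endpoint profiles `g` and source densities `h`), the four functionals `J₁[g]` (main transfer),
`J₂[g,h]` (source-density transfer), `V[g]`, `W[h]` (Dirichlet visibilities), the FIXED calibration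
constants `α, β > 0` of Prop 3.3 (p.12: "There exist fixed positive constants `α, β`"; p.14: "provided the
same constants are used in the terminal balance and in the quotient"), the amplitude actions `g ↦ ag`,
`h ↦ bh` (`a, b > 0`) and the PRINTED laws "`J₁[g_a] = a³J₁[g]`, `J₂[g_a,h] = aJ₂[g,h]`, `V[g_a] = a²V[g]`"
(l.788–792), "`J₂[g,h_b] = b²J₂[g,h]`, `W[h_b] = b²W[h]`" (l.793–797). Nothing else: no maximiser, no
stationarity field. The paper's concrete functionals are an instance (`liftedPairClass`).
[cite: Shahmurov2026TwoPart, §5 p.14–15] -/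
structure PairClass where
  /-- Carrier of endpoint `G`-profiles `g`. -/
  CarrierG : Type
  /-- Carrier of endpoint source densities `h` (limits of `H = F²`). -/
  CarrierH : Type
  /-- Main transfer `J₁[g] = ∫ χ² g² U[g]`. -/
  J₁ : CarrierG → ℝ
  /-- Source-density transfer `J₂[g,h] = ∫ χ² U[g] h²`. -/
  J₂ : CarrierG → CarrierH → ℝ
  /-- Dirichlet visibility of `g`. -/
  V : CarrierG → ℝ
  /-- Dirichlet (entropy) visibility of `h`. -/
  W : CarrierH → ℝ
  /-- Coefficient of the source-density transfer in `𝕁 = J₁ − αJ₂` (Prop 3.3). -/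
  α : ℝ
  /-- Weight of the entropy visibility in `𝔸 = V + βW` (Prop 3.3). -/
  β : ℝ
  α_pos : 0 < α
  β_pos : 0 < β
  /-- Amplitude action `g ↦ a g`. -/
  ampG : ℝ → CarrierG → CarrierG
  /-- Amplitude action `h ↦ b h`. -/
  ampH : ℝ → CarrierH → CarrierH
  J₁_ampG : ∀ a : ℝ, 0 < a → ∀ g, J₁ (ampG a g) = a ^ 3 * J₁ g
  J₂_ampG : ∀ a : ℝ, 0 < a → ∀ g h, J₂ (ampG a g) h = a * J₂ g h
  V_ampG : ∀ a : ℝ, 0 < a → ∀ g, V (ampG a g) = a ^ 2 * V g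
  J₂_ampH : ∀ b : ℝ, 0 < b → ∀ g h, J₂ g (ampH b h) = b ^ 2 * J₂ g h
  W_ampH : ∀ b : ℝ, 0 < b → ∀ h, W (ampH b h) = b ^ 2 * W h

namespace PairClass

/-- The pair visibility `𝔸[g,h] = V[g] + βW[h]` (l.697, p.14; (3.3) p.11). [cite: Shahmurov2026TwoPart, §5 p.14] -/
def A (C : PairClass) (g : C.CarrierG) (h : C.CarrierH) : ℝ := C.V g + C.β * C.W h

/-- The pair transfer `𝕁[g,h] = J₁[g] − αJ₂[g,h]` (l.698, p.14; (3.5) p.11). [cite: Shahmurov2026TwoPart, §5 p.14] -/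
def J (C : PairClass) (g : C.CarrierG) (h : C.CarrierH) : ℝ := C.J₁ g - C.α * C.J₂ g h

/-- **Dilation data** for a pair class (Prop 5.3 proof, l.818–839, p.15): ONE dilation action `s > 0` on both
carriers ("the mass-preserving spatial dilation in the lifted five-dimensional variables
`g_s(Y) = s^{5/2}g(sY)`, `h_s(Y) = s^{5/2}h(sY)`") with the PRINTED laws "The visibility has degree two:
`V[g_s] = s²V[g]`, `W[h_s] = s²W[h]`" and "both transfer terms have degree `3/2`: `J₁[g_s] = s^{3/2}J₁[g]`,
`J₂[g_s,h_s] = s^{3/2}J₂[g,h]`" as fields. [cite: Shahmurov2026TwoPart, Prop 5.3 proof p.15] -/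
structure Dilation (C : PairClass) where
  /-- Dilation of `g`-profiles. -/
  dilG : ℝ → C.CarrierG → C.CarrierG
  /-- Dilation of `h`-profiles. -/
  dilH : ℝ → C.CarrierH → C.CarrierH
  V_dil : ∀ s : ℝ, 0 < s → ∀ g, C.V (dilG s g) = s ^ 2 * C.V g
  W_dil : ∀ s : ℝ, 0 < s → ∀ h, C.W (dilH s h) = s ^ 2 * C.W h
  J₁_dil : ∀ s : ℝ, 0 < s → ∀ g, C.J₁ (dilG s g) = s ^ (3 / 2 : ℝ) * C.J₁ g
  J₂_dil : ∀ s : ℝ, 0 < s → ∀ g h, C.J₂ (dilG s g) (dilH s h) = s ^ (3 / 2 : ℝ) * C.J₂ g h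

end PairClass

/-- **Step I-5.2 = Proposition 5.2 "Endpoint quotient Euler identities"** (statement p.14, proof p.15,
l.763–807), AS PRINTED, over the abstract pair class: "Let `(g,h)` be the strong endpoint profile from
Proposition 5.1, and suppose it saturates the endpoint quotient `Λ_* = 𝕁[g,h]/𝔸[g,h]`. Then the gauge-free
amplitude identities hold: (17) `3J₁[g] − αJ₂[g,h] = 2Λ_*V[g]`, (18) `−αJ₂[g,h] = Λ_*βW[h]`." The hypothesis is
exactly Prop 5.1's output `𝔸[g,h] = 1`, `𝕁[g,h] = Λ_*`, with `0 < Λ_*`. Printed ground (l.783–787): "The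
quotient is gauge-free; no separate `L²`-normalization is imposed. Equivalently, after normalizing
`𝔸[g,h] = 1`, the profile is stationary for `𝕁 − Λ_*𝔸` under admissible compactly supported variations and
under the amplitude curves below." — typed separately as `Prop52Stationarity`; `prop52_of_stationarity` is
the printed derivation. See `noSaturatingProfile_of_prop52` for the shape of this statement.
[claim: Shahmurov2026TwoPart, status: under-review] -/
def Prop52 : Prop :=
  ∀ (C : PairClass) (g : C.CarrierG) (h : C.CarrierH) (Λ : ℝ),
    C.A g h = 1 → C.J g h = Λ → 0 < Λ →
      3 * C.J₁ g - C.α * C.J₂ g h = 2 * Λ * C.V g ∧ -(C.α * C.J₂ g h) = Λ * (C.β * C.W h)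

/-- **Step I-5.3 = Proposition 5.3 "Zero-error localized Pohozaev–Morawetz identity"** (p.15, l.809–849), AS
PRINTED, over the abstract pair class with dilation data: "The endpoint profile `(g,h)` satisfies (20)
`(3/2)𝕁[g,h] = 2Λ_*𝔸[g,h]`." Printed ground (l.840–848): "The finite-stage localized Pohozaev–Morawetz identity
is the integration-by-parts version of this dilation computation. All cutoff, transport, tail, endpoint, and
square-density concentration commutators belong to `𝔼_dir + 𝔹_end` by Lemma 5.7; these quantities vanish
along the zero-error sequence in Proposition 5.1. Passing to the strong limit therefore gives exact
stationarity of `𝕁 − Λ_*𝔸` along the dilation curve. Differentiating at `s = 1` yields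
`(3/2)𝕁[g,h] − 2Λ_*𝔸[g,h] = 0`." (No finite-stage Pohozaev–Morawetz identity for the `G`/`H` system is
displayed anywhere in the text.) The stationarity premise is `Prop53Stationarity`; `prop53_of_stationarity`
is the printed derivation. Not consumed by `claim_of_steps` (see `thm54_algebra`).
[claim: Shahmurov2026TwoPart, status: under-review] -/
def Prop53 : Prop :=
  ∀ (C : PairClass) (_D : C.Dilation) (g : C.CarrierG) (h : C.CarrierH) (Λ : ℝ),
    C.A g h = 1 → C.J g h = Λ → 0 < Λ → (3 / 2 : ℝ) * C.J g h = 2 * Λ * C.A g h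

/-- **«Implicit» premise of the proof of Prop 5.2** (l.783–787, p.15, quoted in `Prop52`): the endpoint
profile is stationary for `𝕁 − Λ_*𝔸` along the two amplitude curves `a ↦ (ag, h)` and `b ↦ (g, bh)` at
`a = b = 1`. This is the premise the printed proof uses ("Differentiating `𝕁[g_a,h] − Λ_*𝔸[g_a,h]` at `a = 1`
gives (17)"); nothing in print establishes it (the class over which `Λ_*` is extremal is not defined; Prop 5.1
delivers a limit of normalised packets of a solution). [claim: Shahmurov2026TwoPart, status: under-review] -/
def Prop52Stationarity : Prop :=
  ∀ (C : PairClass) (g : C.CarrierG) (h : C.CarrierH) (Λ : ℝ),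
    C.A g h = 1 → C.J g h = Λ → 0 < Λ →
      HasDerivAt (fun a : ℝ => C.J (C.ampG a g) h - Λ * C.A (C.ampG a g) h) 0 1 ∧
      HasDerivAt (fun b : ℝ => C.J g (C.ampH b h) - Λ * C.A g (C.ampH b h)) 0 1

/-- **«Implicit» premise of the proof of Prop 5.3** (l.844, p.15, quoted in `Prop53`): "exact stationarity of
`𝕁 − Λ_*𝔸` along the dilation curve" at `s = 1`. [claim: Shahmurov2026TwoPart, status: under-review] -/
def Prop53Stationarity : Prop :=
  ∀ (C : PairClass) (D : C.Dilation) (g : C.CarrierG) (h : C.CarrierH) (Λ : ℝ),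
    C.A g h = 1 → C.J g h = Λ → 0 < Λ →
      HasDerivAt (fun s : ℝ => C.J (D.dilG s g) (D.dilH s h) - Λ * C.A (D.dilG s g) (D.dilH s h)) 0 1

/-- **The printed proof of Prop 5.2** (l.787–798, p.15), kernel-checked: along `a ↦ (ag,h)` the functional
`𝕁 − Λ_*𝔸` is the polynomial `a³J₁ − αaJ₂ − Λ_*(a²V + βW)` for `a > 0`, whose derivative at `1` is
`3J₁ − αJ₂ − 2Λ_*V`; along `b ↦ (g,bh)` it is `J₁ − αb²J₂ − Λ_*(V + βb²W)` with derivative `−2αJ₂ − 2Λ_*βW`.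
Stationarity therefore gives (17) and (18). [cite: Shahmurov2026TwoPart, Prop 5.2 proof p.15] -/
theorem prop52_of_stationarity (hst : Prop52Stationarity) : Prop52 := by
  intro C g k Λ hA hJ hΛ
  obtain ⟨h1, h2⟩ := hst C g k Λ hA hJ hΛ
  -- the curve `a ↦ (ag, h)`
  have e1 : (fun a : ℝ => a ^ 3 * C.J₁ g - C.α * (a * C.J₂ g k) -
        Λ * (a ^ 2 * C.V g + C.β * C.W k)) =ᶠ[𝓝 1]
      fun a : ℝ => C.J (C.ampG a g) k - Λ * C.A (C.ampG a g) k := by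
    filter_upwards [Ioi_mem_nhds (zero_lt_one : (0 : ℝ) < 1)] with a ha
    simp only [PairClass.J, PairClass.A, C.J₁_ampG a ha g, C.J₂_ampG a ha g k, C.V_ampG a ha g]
  have h1' : HasDerivAt (fun a : ℝ => a ^ 3 * C.J₁ g - C.α * (a * C.J₂ g k) -
      Λ * (a ^ 2 * C.V g + C.β * C.W k)) 0 1 := h1.congr_of_eventuallyEq e1
  have d1 := (((hasDerivAt_pow 3 (1 : ℝ)).mul_const (C.J₁ g)).sub
      ((hasDerivAt_id' (1 : ℝ)).mul_const (C.J₂ g k) |>.const_mul C.α)).sub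
    ((((hasDerivAt_pow 2 (1 : ℝ)).mul_const (C.V g)).add_const (C.β * C.W k)).const_mul Λ)
  have key1 := h1'.unique d1
  norm_num at key1
  -- the curve `b ↦ (g, bh)`
  have e2 : (fun b : ℝ => C.J₁ g - C.α * (b ^ 2 * C.J₂ g k) -
        Λ * (C.V g + C.β * (b ^ 2 * C.W k))) =ᶠ[𝓝 1]
      fun b : ℝ => C.J g (C.ampH b k) - Λ * C.A g (C.ampH b k) := by
    filter_upwards [Ioi_mem_nhds (zero_lt_one : (0 : ℝ) < 1)] with b hb
    simp only [PairClass.J, PairClass.A, C.J₂_ampH b hb g k, C.W_ampH b hb k]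
  have h2' : HasDerivAt (fun b : ℝ => C.J₁ g - C.α * (b ^ 2 * C.J₂ g k) -
      Λ * (C.V g + C.β * (b ^ 2 * C.W k))) 0 1 := h2.congr_of_eventuallyEq e2
  have d2 := ((((hasDerivAt_pow 2 (1 : ℝ)).mul_const (C.J₂ g k)).const_mul C.α).const_sub
      (C.J₁ g)).sub
    (((((hasDerivAt_pow 2 (1 : ℝ)).mul_const (C.W k)).const_mul C.β).const_add (C.V g)).const_mul Λ)
  have key2 := h2'.unique d2
  norm_num at key2
  constructor
  · linarith
  · linarith

/-- **The printed proof of Prop 5.3** (l.818–848, p.15), kernel-checked: along the dilation curve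
`𝕁 − Λ_*𝔸` equals `s^{3/2}𝕁 − Λ_*s²𝔸` for `s > 0` ("The visibility has degree two … both transfer terms have
degree `3/2`"), whose derivative at `s = 1` is `(3/2)𝕁 − 2Λ_*𝔸`; stationarity gives (20).
[cite: Shahmurov2026TwoPart, Prop 5.3 proof p.15] -/
theorem prop53_of_stationarity (hst : Prop53Stationarity) : Prop53 := by
  intro C D g k Λ hA hJ hΛ
  have h3 := hst C D g k Λ hA hJ hΛ
  have e3 : (fun s : ℝ => s ^ (3 / 2 : ℝ) * C.J₁ g - C.α * (s ^ (3 / 2 : ℝ) * C.J₂ g k) -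
        Λ * (s ^ 2 * C.V g + C.β * (s ^ 2 * C.W k))) =ᶠ[𝓝 1]
      fun s : ℝ => C.J (D.dilG s g) (D.dilH s k) - Λ * C.A (D.dilG s g) (D.dilH s k) := by
    filter_upwards [Ioi_mem_nhds (zero_lt_one : (0 : ℝ) < 1)] with s hs
    simp only [PairClass.J, PairClass.A, D.J₁_dil s hs g, D.J₂_dil s hs g k, D.V_dil s hs g,
      D.W_dil s hs k]
  have h3' : HasDerivAt (fun s : ℝ => s ^ (3 / 2 : ℝ) * C.J₁ g - C.α * (s ^ (3 / 2 : ℝ) * C.J₂ g k) -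
      Λ * (s ^ 2 * C.V g + C.β * (s ^ 2 * C.W k))) 0 1 := h3.congr_of_eventuallyEq e3
  have r : HasDerivAt (fun s : ℝ => s ^ (3 / 2 : ℝ)) ((3 / 2 : ℝ) * (1 : ℝ) ^ ((3 / 2 : ℝ) - 1)) 1 :=
    Real.hasDerivAt_rpow_const (Or.inl one_ne_zero)
  have d3 := ((r.mul_const (C.J₁ g)).sub ((r.mul_const (C.J₂ g k)).const_mul C.α)).sub
    ((((hasDerivAt_pow 2 (1 : ℝ)).mul_const (C.V g)).add
      (((hasDerivAt_pow 2 (1 : ℝ)).mul_const (C.W k)).const_mul C.β)).const_mul Λ)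
  have key3 := h3'.unique d3
  simp only [Real.one_rpow] at key3
  norm_num at key3
  simp only [PairClass.J, PairClass.A]
  linarith

/-- **(19) "Consequently, `3𝕁[g,h] = 2Λ_*𝔸[g,h]`"** (p.14–15, l.776–780; printed derivation l.798–806),
from (17) and (18): pure algebra, kernel-checked. [cite: Shahmurov2026TwoPart, Prop 5.2 (19) p.15] -/
theorem prop52_total (h52 : Prop52) (C : PairClass) (g : C.CarrierG) (h : C.CarrierH) (Λ : ℝ)
    (hA : C.A g h = 1) (hJ : C.J g h = Λ) (hΛ : 0 < Λ) : 3 * C.J g h = 2 * Λ * C.A g h := by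
  obtain ⟨e1, e2⟩ := h52 C g h Λ hA hJ hΛ
  simp only [PairClass.J, PairClass.A]
  linear_combination e1 + 2 * e2

/-- **"No coefficient-one endpoint saturator"** — the content of Thm 5.4's proof by contradiction (p.15) in
the abstract class: no pair class carries a profile with `𝔸 = 1`, `𝕁 = Λ_*`, `Λ_* > 0` (cf. D-I v3 Thm 3.14
"No zero-error saturator", AX v1 Thm 32.3 "No coefficient-one endpoint saturator" — the same step in the
cluster's other generations). A `def`, asserted nowhere; derived from `Prop52` below.
[claim: Shahmurov2026TwoPart, status: under-review] -/
def NoSaturatingProfile : Prop :=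
  ∀ (C : PairClass) (g : C.CarrierG) (h : C.CarrierH) (Λ : ℝ),
    C.A g h = 1 → C.J g h = Λ → 0 < Λ → False

/-- **Prop 5.2 alone excludes every saturating profile** (FAILURE-MODES F16 shape, recorded for the referee):
(17) ∧ (18) together with the hypotheses `𝕁 = Λ_*𝔸`, `𝔸 = 1` force `Λ_*(V + βW) = Λ_* = 0`, contradicting
`Λ_* > 0`. Hence `Prop52` as printed holds iff its hypothesis class is empty in every pair class, and the
dilation identity Prop 5.3 is not needed for Thm 5.4. Pure algebra. [cite: Shahmurov2026TwoPart, Prop 5.2 and Thm 5.4 proof p.15] -/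
theorem noSaturatingProfile_of_prop52 (h52 : Prop52) : NoSaturatingProfile := by
  intro C g h Λ hA hJ hΛ
  obtain ⟨e1, e2⟩ := h52 C g h Λ hA hJ hΛ
  simp only [PairClass.J, PairClass.A] at hJ hA
  have hzero : Λ = 0 := by linear_combination e1 - 3 * hJ + 2 * e2 + 2 * Λ * hA
  exact absurd hzero hΛ.ne'

/-- **The printed proof of Theorem 5.4** (p.15, l.859–866), kernel-checked as algebra: (19) and (20) give
"`3𝕁 = 2Λ_*𝔸 = (3/2)𝕁`. Thus `𝕁 = 0`. Since `𝕁 = Λ_*𝔸`, `𝔸 = 1`, and `Λ_* > 0`, this is impossible."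
((19) alone already suffices: `3Λ_* = 2Λ_*`.) [cite: Shahmurov2026TwoPart, Thm 5.4 proof p.15] -/
theorem thm54_algebra {A J Λ : ℝ} (h19 : 3 * J = 2 * Λ * A) (_h20 : (3 / 2 : ℝ) * J = 2 * Λ * A)
    (hJ : J = Λ * A) (hA : A = 1) (hΛ : 0 < Λ) : False := by
  subst hA
  have : Λ = 0 := by nlinarith
  exact absurd this hΛ.ne'

/-! ## C. The paper's concrete functionals on the lifted space (§2 p.7–10, §5 p.14) form a `PairClass` -/

/-- **The recovered strain** `U[g] = u^r/r = −∂_z(−Δ₅)⁻¹g` (eq. (2.5), l.444–448, p.9; dictionary p.7: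
"an order `−1` potential of `G`"), realised as the convolution of `g` with the `z`-derivative of the
Newtonian kernel `Γ` of `ℝ⁵` (`Literature.Analysis.PDE.Newtonian.kernel 0`, normalised by `Δ(Γ * g) = g`,
so `(−Δ₅)⁻¹g = −Γ * g` and `U[g] = ∂_z(Γ * g) = (∂_zΓ) * g`). Bochner integral (value `0` off
integrability; the kernel `|∂_zΓ| ≲ |X|^{-4}` is locally integrable in `ℝ⁵`).
[cite: Shahmurov2026TwoPart, eq. (2.5) p.9] -/
def recoveredStrain (g : E5 → ℝ) (x : E5) : ℝ :=
  ∫ y, (fderiv ℝ (_root_.Literature.Analysis.PDE.Newtonian.kernel (E := E5) 0) (x - y))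
      (EuclideanSpace.single 4 1) * g y

/-- **Localized Dirichlet visibility** on the unit terminal core (l.702–705, p.14; (3.1)–(3.2) p.11):
`V[g] = ∫ χ²|∇₅g|² + ∫ |∇₅χ|²g²` (`W[h]` is the same expression in `h`), `χ` the standard terminal cutoff
(p.8, l.315–321). [cite: Shahmurov2026TwoPart, §5 p.14] -/
def visibility (χ g : E5 → ℝ) : ℝ :=
  (∫ x, χ x ^ 2 * ‖fderiv ℝ g x‖ ^ 2) + ∫ x, ‖fderiv ℝ χ x‖ ^ 2 * g x ^ 2

/-- **Main transfer** `J₁[g] = ∫ χ² g² U[g]` (l.707, p.14; `𝕋_{G,χ}` of (3.4) p.11). [cite: Shahmurov2026TwoPart, §5 p.14] -/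
def transferG (χ g : E5 → ℝ) : ℝ :=
  ∫ x, χ x ^ 2 * g x ^ 2 * recoveredStrain g x

/-- **Source-density transfer** `J₂[g,h] = ∫ χ² U[g] h²` (l.709, p.14; `𝕋_{H,χ}` of (3.4) p.11).
[cite: Shahmurov2026TwoPart, §5 p.14] -/
def transferH (χ g h : E5 → ℝ) : ℝ :=
  ∫ x, χ x ^ 2 * recoveredStrain g x * h x ^ 2

/-- `U` is linear under amplitude scaling: `U[ag] = aU[g]` ("Since `U[ag] = aU[g]`", l.787, p.15).
[cite: Shahmurov2026TwoPart, Prop 5.2 proof p.15] -/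
theorem recoveredStrain_constMul (a : ℝ) (g : E5 → ℝ) :
    recoveredStrain (fun x => a * g x) = fun x => a * recoveredStrain g x := by
  funext x
  simp only [recoveredStrain]
  rw [← integral_const_mul]
  congr 1
  funext y
  ring

/-- `D(ag) = a Dg` pointwise, with Mathlib's total derivative (no differentiability needed). [folklore] -/
private theorem fderiv_constMul (a : ℝ) (g : E5 → ℝ) (x : E5) :
    fderiv ℝ (fun y => a * g y) x = a • fderiv ℝ g x := by
  have h : (fun y => a * g y) = a • g := by
    funext y
    simp [smul_eq_mul]
  rw [h, fderiv_const_smul_field]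
  rfl

/-- Amplitude law `V[ag] = a²V[g]` (l.791, p.15), PROVED for the concrete functional.
[cite: Shahmurov2026TwoPart, Prop 5.2 proof p.15] -/
theorem visibility_constMul (χ : E5 → ℝ) (a : ℝ) (g : E5 → ℝ) :
    visibility χ (fun x => a * g x) = a ^ 2 * visibility χ g := by
  simp only [visibility, fderiv_constMul, norm_smul, Real.norm_eq_abs, mul_pow, sq_abs]
  rw [mul_add, ← integral_const_mul, ← integral_const_mul]
  congr 1
  · congr 1
    funext x
    ring
  · congr 1
    funext x
    ring

/-- Amplitude law `J₁[ag] = a³J₁[g]` (l.789, p.15), PROVED for the concrete functional.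
[cite: Shahmurov2026TwoPart, Prop 5.2 proof p.15] -/
theorem transferG_constMul (χ : E5 → ℝ) (a : ℝ) (g : E5 → ℝ) :
    transferG χ (fun x => a * g x) = a ^ 3 * transferG χ g := by
  simp only [transferG, recoveredStrain_constMul]
  rw [← integral_const_mul]
  congr 1
  funext x
  ring

/-- Amplitude law `J₂[ag,h] = aJ₂[g,h]` (l.790, p.15), PROVED for the concrete functional.
[cite: Shahmurov2026TwoPart, Prop 5.2 proof p.15] -/
theorem transferH_constMul_left (χ : E5 → ℝ) (a : ℝ) (g h : E5 → ℝ) :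
    transferH χ (fun x => a * g x) h = a * transferH χ g h := by
  simp only [transferH, recoveredStrain_constMul]
  rw [← integral_const_mul]
  congr 1
  funext x
  ring

/-- Amplitude law `J₂[g,bh] = b²J₂[g,h]` (l.795, p.15), PROVED for the concrete functional.
[cite: Shahmurov2026TwoPart, Prop 5.2 proof p.15] -/
theorem transferH_constMul_right (χ : E5 → ℝ) (b : ℝ) (g h : E5 → ℝ) :
    transferH χ g (fun x => b * h x) = b ^ 2 * transferH χ g h := by
  simp only [transferH]
  rw [← integral_const_mul]
  congr 1
  funext x
  ring

/-- **The paper's endpoint functionals ARE a pair class** (l.697–711, p.14): carriers = scalar fields on the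
lifted `ℝ⁵`, `J₁ = transferG χ`, `J₂ = transferH χ`, `V = W = visibility χ`, the calibration `α, β > 0` of
Prop 3.3, amplitude actions `g ↦ ag`, `h ↦ bh`; the five amplitude laws are the theorems above. (No
`Dilation` structure is built here: with the FIXED cutoff `χ` the printed law `V[g_s] = s²V[g]` of l.826 is
not an identity of this functional — the paper routes the cutoff commutators into `𝔼_dir + 𝔹_end`, l.840–844.)
[cite: Shahmurov2026TwoPart, §5 p.14–15] -/
def liftedPairClass (α β : ℝ) (hα : 0 < α) (hβ : 0 < β) (χ : E5 → ℝ) : PairClass where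
  CarrierG := E5 → ℝ
  CarrierH := E5 → ℝ
  J₁ := transferG χ
  J₂ := transferH χ
  V := visibility χ
  W := visibility χ
  α := α
  β := β
  α_pos := hα
  β_pos := hβ
  ampG := fun a g x => a * g x
  ampH := fun b h x => b * h x
  J₁_ampG := fun a _ g => transferG_constMul χ a g
  J₂_ampG := fun a _ g h => transferH_constMul_left χ a g h
  V_ampG := fun a _ g => visibility_constMul χ a g
  J₂_ampH := fun b _ g h => transferH_constMul_right χ b g h
  W_ampH := fun b _ h => visibility_constMul χ b h

/-- `SO(4)`-radiality of a lifted scalar (l.410–425, p.9: "Smooth axisymmetric scalar fields with the correct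
parity at the axis correspond to smooth `SO(4)`-radial lifted functions"): `f` depends only on `(|y|, z)`,
junk-free form "equal norm and equal `z`-coordinate ⇒ equal value". [cite: Shahmurov2026TwoPart, §2 p.9] -/
def IsSO4Radial (f : E5 → ℝ) : Prop :=
  ∀ x y : E5, ‖x‖ = ‖y‖ → x 4 = y 4 → f x = f y

/-! ## D. Part I bookkeeping (prose-defined in print) and the Part I steps -/

/-- **The Part I bookkeeping attached to smooth axisymmetric Navier–Stokes solutions** — carried as an explicit
parameter because the print defines it in prose: the calibration constants `α, β > 0` of Prop 3.3 (p.12); the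
standard terminal cutoff `χ` on the lifted space (p.8); the class `Cyl` of (normalised) terminal parabolic
cylinders / packets of smooth axisymmetric solutions on their smooth intervals (Defs 2.2–2.3, p.9: threshold
crossings of the corrected score `𝒬_λ(z₀,t) = λ∫_{B_λ^{axis}(z₀)}G(t)²dμ₅` at a fixed large `Q_*`, the
cylinder `(t − c₀λ², t) × B_{2λ}^{axis}(z₀)` "together with the normalized pair `(G,H)`, the cutoff `χ`, and
the pair budgets measured on it"); the predicates "compact-critical" (Def 2.3 p.9: `𝕄_G³ + 𝕄_H³ > η𝔸_χ`)
and "canonical first-threshold" (Def 2.2 p.9, Def 8.1 p.21: minimal under "earlier endpoint time ≺ smaller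
active scale ≺ fewer separated active components ≺ more localized residual channel"); and the four
real-valued quantities of a cylinder: `𝔸_χ` (3.3), `𝕁_χ` (3.5) (p.11), `𝔼_dir` (§2.2 p.7–8 and the table
§7.1 p.20–21: `D_leak^tot + P_tail^{1/2} + P_tail + R_low + S_Γ + D_frag + D_freq`, each described in words),
`𝔹_end` (Prop 3.3 p.12: "the two endpoint masses of `χG` and `χH`"; `𝓑₀` in Lemma 6.1 / Prop 6.2
p.17–18: "the fixed large-scale contribution"). Opaque carrier for pure bookkeeping (cell convention 3); a
verdict on a `K`-dependent step is a verdict on this prose. [cite: Shahmurov2026TwoPart, Defs 2.1–2.4 p.8–9, §7.1 p.20–21, Def 8.1 p.21] -/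
structure TerminalBookkeeping where
  /-- Calibration constant `α` of Prop 3.3. -/
  α : ℝ
  /-- Calibration constant `β` of Prop 3.3. -/
  β : ℝ
  α_pos : 0 < α
  β_pos : 0 < β
  /-- The standard terminal cutoff on the lifted space (p.8). -/
  χ : E5 → ℝ
  /-- Terminal parabolic cylinders (packets) of smooth axisymmetric solutions (Defs 2.2–2.3, p.9). -/
  Cyl : Type
  /-- "compact-critical" (Def 2.3, p.9). -/
  compactCritical : Cyl → Prop
  /-- "canonical first-threshold terminal packet" (Def 2.2 p.9, Def 8.1 p.21). -/
  firstThreshold : Cyl → Prop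
  /-- Pair visibility `𝔸_χ[G,H;I]` of the cylinder ((3.3), p.11). -/
  A : Cyl → ℝ
  /-- Pair transfer `𝕁_χ[G,H;I]` of the cylinder ((3.5), p.11). -/
  J : Cyl → ℝ
  /-- Lower-order terminal budget `𝔼_dir` (§2.2, §7.1). -/
  Edir : Cyl → ℝ
  /-- Endpoint masses `𝔹_end` (Prop 3.3) / `𝓑₀` (Prop 6.2). -/
  Bend : Cyl → ℝ

/-- The concrete lifted pair class at the bookkeeping's calibration `α, β` and cutoff `χ` (the class in which
Prop 5.1's endpoint profile lives, l.695–711 p.14). [cite: Shahmurov2026TwoPart, §5 p.14] -/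
def TerminalBookkeeping.pairClass (K : TerminalBookkeeping) : PairClass :=
  liftedPairClass K.α K.β K.α_pos K.β_pos K.χ

/-- **Theorem 5.4 "Terminal strict pair bridge"** (p.15, l.851–858), AS PRINTED, over the bookkeeping `K`:
"There exist constants `θ_* < 1` and `C < ∞`, independent of the terminal packet, such that every
compact-critical terminal cylinder satisfies `|𝕁_χ[G,H;I]| ≤ θ_*𝔸_χ[G,H;I] + C𝔼_dir(I) + C𝔹_end(I)`."
The load-bearing statement consumed by Cor 5.5 (p.16) and Prop 6.2 (p.18). A `def`; derived from
`Step_I51` and `Prop52` in `strictBridge_of_steps` (the paper's own route).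
[claim: Shahmurov2026TwoPart, status: under-review] -/
def StrictBridge (K : TerminalBookkeeping) : Prop :=
  ∃ θ : ℝ, θ < 1 ∧ ∃ C : ℝ, ∀ c : K.Cyl, K.compactCritical c →
    |K.J c| ≤ θ * K.A c + C * K.Edir c + C * K.Bend c

/-- **Step I-5.1 = Proposition 5.1 "TSD compactness for endpoint-saturating packets"** (p.14, l.715–761)
together with the first two sentences of the proof of Thm 5.4 (p.15, l.860: "Assume that no such `θ_* < 1`
exists. Then there is a normalized compact-critical terminal sequence satisfying the hypotheses of
Proposition 5.1 with endpoint quotient `Λ_* > 0` equal to the coefficient-one saturation value"): IF the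
strict bridge fails, THEN (Prop 5.1) "there is a subsequence and functions `(g,h)` such that `G_n → g`,
`H_n → h` strongly in the local spaces needed to pass to the pair transfer and visibility. In particular,
`𝔸[g,h] = 1`, `𝕁[g,h] = Λ_*`." — an endpoint profile IN THE PAPER'S CONCRETE LIFTED CLASS at the calibration
of `K`, `SO(4)`-radial, with `h ≥ 0` (limit of `H_n = F_n² ≥ 0`) and `Λ_* > 0`. Proof in print: App. A
negative-Sobolev time compactness + the inverse-potential detector (Lemmas A.1–A.7, Prop A.8, pp.35–40) +
"Lower semicontinuity gives `𝔸[g,h] ≤ 1`, while saturation and the normalization force equality; otherwise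
the normalized quotient would improve after rescaling the limit, contradicting the definition of `Λ_*`"
(l.760, p.14). [claim: Shahmurov2026TwoPart, status: under-review] -/
def Step_I51 (K : TerminalBookkeeping) : Prop :=
  ¬ StrictBridge K →
    ∃ (g h : E5 → ℝ) (Λ : ℝ), IsSO4Radial g ∧ IsSO4Radial h ∧ (∀ x, 0 ≤ h x) ∧
      K.pairClass.A g h = 1 ∧ K.pairClass.J g h = Λ ∧ 0 < Λ

/-- "No first-threshold terminal cylinder exists" — the conclusion of **Proposition 6.2** (p.18, l.1015:
"Hence no first-threshold terminal cylinder exists"), over the bookkeeping `K`. A `def`, asserted nowhere.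
[claim: Shahmurov2026TwoPart, status: under-review] -/
def NoFirstThresholdPacket (K : TerminalBookkeeping) : Prop :=
  ∀ c : K.Cyl, ¬ K.firstThreshold c

/-- **Step I-6.2 = the terminal contradiction assembled** (Prop 3.3 "coefficient-calibrated pair balance"
`𝔸_χ ≤ 𝕁_χ + C𝔼_dir + C𝔹_end` p.12; Lemma 4.1 / Cor 4.2 soft bridge and subcritical absorption p.13;
Cor 5.5 p.16 "Endpoint selection and the terminal hierarchy give `C𝔼_dir + C𝔹_end ≤ ((1−θ_*)/2)𝔸_χ`. Thus
`𝔸_χ = 0`, contradicting the positive corrected score"; Lemma 5.7 / Cor 5.8 p.16–17; Lemma 6.1 endpoint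
selection p.17; **Proposition 6.2** p.18; Lemmas 8.2–8.3, Prop 8.4 `𝔼_dir[Q_*] ≤ δ_*𝔸_χ[Q_*]` p.21–22):
GIVEN the strict bridge (Thm 5.4), no first-threshold terminal cylinder exists. (Remark for the refuter, not a
verdict: Lemma 6.1's proof, p.17, bounds the endpoint masses in the compact-critical case by "part of the
normalized mass … dominated by the terminal visibility lower bound", while Cor 5.5 / Prop 6.2 absorb them as
a SMALL fraction `((1−θ_*)/2)𝔸_χ`.) [claim: Shahmurov2026TwoPart, status: under-review] -/
def Step_I62 (K : TerminalBookkeeping) : Prop :=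
  StrictBridge K → NoFirstThresholdPacket K

/-- **Step I-9.1 = Proposition 9.1 "Continuation failure implies threshold crossing" and the proof of Main
Theorem 1.1** (p.23, l.1279–1291: "If the maximal smooth time `T_* < ∞`, then for every sufficiently large
threshold `Q_*` there exists a first-threshold terminal packet before `T_*`"; its proof uses §7: Lemmas
7.1–7.4 and **Proposition 7.5** "Axisymmetric continuation from bounded score and source envelopes", p.18–20),
in contrapositive form over the bookkeeping `K`: if no first-threshold terminal packet exists, Main Thm 1.1
holds. [claim: Shahmurov2026TwoPart, status: under-review] -/
def Step_I91 (K : TerminalBookkeeping) : Prop :=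
  NoFirstThresholdPacket K → ClaimedTheoremAxisym

/-- **Theorem 5.4 from Step I-5.1 and Prop 5.2** — the paper's proof of Thm 5.4 (p.15) re-run in the kernel:
if the strict bridge failed, Step I-5.1 would give a saturating profile in the concrete lifted pair class,
which `Prop52` excludes in EVERY pair class (`noSaturatingProfile_of_prop52`). Prop 5.3 is not used.
[cite: Shahmurov2026TwoPart, Thm 5.4 proof p.15] -/
theorem strictBridge_of_steps (K : TerminalBookkeeping) (h51 : Step_I51 K) (h52 : Prop52) :
    StrictBridge K := by
  by_contra hns
  obtain ⟨g, h, Λ, -, -, -, hA, hJ, hΛ⟩ := h51 hns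
  exact noSaturatingProfile_of_prop52 h52 K.pairClass g h Λ hA hJ hΛ

/-- **Main Theorem 1.1 from the Part I steps** (proof of Main Thm 1.1, p.23: "Assume `T_* < ∞`. By
Proposition 9.1, select a first-threshold terminal packet. The terminal contradiction Proposition 6.2 rules
out every such packet."), for the paper's bookkeeping `K`. Pure logic.
[cite: Shahmurov2026TwoPart, proof of Main Thm 1.1 p.23] -/
theorem claimedTheoremAxisym_of_steps (K : TerminalBookkeeping) (h51 : Step_I51 K) (h52 : Prop52)
    (h62 : Step_I62 K) (h91 : Step_I91 K) : ClaimedTheoremAxisym :=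
  h91 (h62 (strictBridge_of_steps K h51 h52))

/-! ## E. Part II (pp.24–34): the full-system front end, typed at its interface -/

/-- **Normalized packet velocity** (Def 12.1, p.25, l.1369–1381): `u^{(r)}(y,s) = r u(x₀ + ry, t₀ + r²s)` on
`Q₂ = (−4,0] × B₂`. [cite: Shahmurov2026TwoPart, Def 12.1 p.25] -/
def packetVelocity (u : ℝ → E3 → E3) (x₀ : E3) (t₀ r : ℝ) : ℝ → E3 → E3 :=
  fun s y => r • u (t₀ + r ^ 2 * s) (x₀ + r • y)

/-- **Normalized packet pressure** (Def 12.1, p.25): `p^{(r)}(y,s) = r² p(x₀ + ry, t₀ + r²s)`.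
[cite: Shahmurov2026TwoPart, Def 12.1 p.25] -/
def packetPressure (p : ℝ → E3 → ℝ) (x₀ : E3) (t₀ r : ℝ) : ℝ → E3 → ℝ :=
  fun s y => r ^ 2 * p (t₀ + r ^ 2 * s) (x₀ + r • y)

/-- **Critical CKN size** of a physical cylinder `Q_r(x₀,t₀) = (t₀ − r², t₀] × B_r(x₀)` (Def 12.3, p.25,
l.1393–1399): `C(u,p;Q_r) = r⁻² ∬_{Q_r} (|u|³ + |p − (p)_{B_r}|^{3/2}) dx dt`, typed with the lower
Lebesgue integral in `ℝ≥0∞` (divergence = `⊤` is the intended reading; TYPING-HYGIENE §2) and the spatial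
ball average of `p` at each time. [cite: Shahmurov2026TwoPart, Def 12.3 p.25] -/
def cknSize (u : ℝ → E3 → E3) (p : ℝ → E3 → ℝ) (x₀ : E3) (t₀ r : ℝ) : ℝ≥0∞ :=
  ENNReal.ofReal (r⁻¹ ^ 2) *
    ∫⁻ t in Ioc (t₀ - r ^ 2) t₀, ∫⁻ x in Metric.ball x₀ r,
      ENNReal.ofReal (‖u t x‖ ^ 3 + |p t x - ⨍ y in Metric.ball x₀ r, p t y| ^ (3 / 2 : ℝ))

/-- The normalized unit cylinder `Q₂ = (−4,0] × B₂` (Def 12.1, p.25). [cite: Shahmurov2026TwoPart, Def 12.1 p.25] -/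
def unitCylinder : Set (ℝ × E3) :=
  Ioc (-4 : ℝ) 0 ×ˢ Metric.ball (0 : E3) 2

/-- A field "after a rigid rotation" `R` (Thm 18.4, p.32: "after passing to a subsequence and applying a
fixed rigid rotation"): `(R·w)(s,y) = R⁻¹ w(s, Ry)`. [cite: Shahmurov2026TwoPart, Thm 18.4 p.32] -/
def rotateField (R : E3 ≃ₗᵢ[ℝ] E3) (w : ℝ → E3 → E3) : ℝ → E3 → E3 :=
  fun s y => R.symm (w s (R y))

/-- **Terminal limit of a singular run** (dictionary p.24–25 "terminal limit"; Lemma 13.1 p.26 "there are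
`x_n ∈ ℝ³`, `t_n ↑ T_*`, `r_n ↓ 0` such that `C(u,p;Q_{r_n}(x_n,t_n)) ≥ ε_CKN > 0`"; Prop 14.1 p.27; Thm 18.4
p.32 "every terminal limit"): `v` is a limit, after one fixed rigid rotation `R`, of the normalized packets of
`(u,p)` along centres `x_n`, times `t_n → T`, scales `r_n → 0` whose cylinders `Q_{2r_n}(x_n,t_n)` lie in the
smooth slab `(0,T) × ℝ³` and carry CKN size `≥ ε`. TYPIST'S READING (flagged): the print never specifies the
topology of the limit; typed as strong convergence in `L³(Q₂)` of the rotated packet velocities — the reading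
most favourable to the handoff of §20. [cite: Shahmurov2026TwoPart, Lemma 13.1 p.26, Thm 18.4 p.32] -/
def IsTerminalLimit (u : ℝ → E3 → E3) (p : ℝ → E3 → ℝ) (T : ℝ) (v : ℝ → E3 → E3) : Prop :=
  ∃ (x : ℕ → E3) (t r : ℕ → ℝ) (R : E3 ≃ₗᵢ[ℝ] E3) (ε : ℝ), 0 < ε ∧
    (∀ n, 0 < r n ∧ 4 * r n ^ 2 < t n ∧ t n < T) ∧
    Tendsto t atTop (𝓝 T) ∧ Tendsto r atTop (𝓝 0) ∧
    (∀ n, ENNReal.ofReal ε ≤ cknSize u p (x n) (t n) (r n)) ∧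
    Tendsto (fun n => ∫⁻ z in unitCylinder,
      ‖rotateField R (packetVelocity u (x n) (t n) (r n)) z.1 z.2 - v z.1 z.2‖ₑ ^ 3) atTop (𝓝 0)

/-- **"Locally two-dimensional branch"** (dictionary p.25: "A terminal limit which, after rotation, is
independent of one spatial coordinate and has velocity tangent to the remaining two variables"; Lemma 18.2
p.31), on `Q₂`, in junk-free translation form: invariant under translations along `e₃` inside `B₂` and
`v · e₃ = 0`. [cite: Shahmurov2026TwoPart, dictionary p.25, Lemma 18.2 p.31] -/
def IsLocallyTwoDimensional (v : ℝ → E3 → E3) : Prop :=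
  ∀ s ∈ Ioc (-4 : ℝ) 0, ∀ y ∈ Metric.ball (0 : E3) 2, ∀ τ : ℝ,
    y + τ • EuclideanSpace.single 2 1 ∈ Metric.ball (0 : E3) 2 →
      v s (y + τ • EuclideanSpace.single 2 1) = v s y ∧ v s y 2 = 0

/-- **"Axisymmetric-with-swirl branch around one fixed axis"** (dictionary p.25: "A terminal limit which, after
rotation, has the cylindrical form used in Part I"; Lemma 18.3 p.32: "`u = u^r(r,z,t)e_r + u^θ(r,z,t)e_θ +
u^z(r,z,t)e_z`"; Thm 18.4 p.32): on `Q₂`, `v(s,·)` is equivariant under the rotations about ONE fixed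
axis `ℓ = c + ℝe₃` (direction `e₃` after the rigid rotation already contained in `IsTerminalLimit`; the axis
need not pass through the packet centre), swirl allowed; junk-free, restricted to points of `B₂`.
[cite: Shahmurov2026TwoPart, Lemma 18.3 and Thm 18.4 p.32] -/
def IsAxisymmetricBranch (v : ℝ → E3 → E3) : Prop :=
  ∃ c : E3, ∀ s ∈ Ioc (-4 : ℝ) 0, ∀ θ : ℝ, ∀ y ∈ Metric.ball (0 : E3) 2,
    c + rotZ θ (y - c) ∈ Metric.ball (0 : E3) 2 → v s (c + rotZ θ (y - c)) = rotZ θ (v s y)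

/-- **A singular run** ("hypothetical singular smooth solution", §1.2 p.4, §11 p.24; Main Thm 11.1 setting):
a smooth finite-energy (Leray–Hopf-class) solution with `C_c^∞` divergence-free datum, `ν = 1`, `f ≡ 0`, on
its maximal smooth interval `[0,T)` with `T < ∞` (no smooth extension past `T`).
[cite: Shahmurov2026TwoPart, Main Thm 11.1 p.24] -/
def IsSingularRun (u : ℝ → E3 → E3) (p : ℝ → E3 → ℝ) (T : ℝ) : Prop :=
  0 < T ∧ IsMaximalSmoothSolution 1 0 u p T ∧ ContDiff ℝ (⊤ : ℕ∞) (u 0) ∧ HasCompactSupport (u 0) ∧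
    NSWave0.IsDivFree (u 0) ∧ IsLerayHopfOn T 1 0 (u 0) u

/-- **Step II (front end) = Steps 1–5 of §11 (p.24): Lemma 13.1 (CKN contrapositive, p.26), Prop 14.1
(canonical minimal packet, p.27), Lemma 14.2 (terminal balance, p.27), Lemma 15.4 (p.28), Prop 16.2 (p.29),
Lemma 17.4 (phase-lock, p.30), Lemmas 18.1–18.3 (p.31–32), Theorem 18.4 "Zero-defect rigidity" (p.32),
Theorem 19.1 "Positive final defect gives loss or descendant" (p.33)**, typed at its interface (the
intermediate objects `𝔇_leak, …, 𝔇_phase`, the active frame measure and the rigid families, Defs 15.1–15.2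
p.28 and 17.1–17.3 p.30, have no displayed mathematical definition): a singular run has a terminal limit
which is "either locally two-dimensional or axisymmetric with swirl around one fixed axis" (Thm 18.4).
[claim: Shahmurov2026TwoPart, status: under-review] -/
def Step_II_frontEnd : Prop :=
  ∀ (u : ℝ → E3 → E3) (p : ℝ → E3 → ℝ) (T : ℝ), IsSingularRun u p T →
    ∃ v : ℝ → E3 → E3, IsTerminalLimit u p T v ∧ (IsLocallyTwoDimensional v ∨ IsAxisymmetricBranch v)

/-- **Step II (2D closure), «implicit»** (Lemma 18.2 last sentence, p.31: "Classical two-dimensional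
regularity rules out a singular terminal branch"; §11 proof l.1337 p.24; §20 l.1870 p.33–34: "A locally
two-dimensional branch is smooth by the classical two-dimensional Navier–Stokes theory and cannot be the
terminal singularity"): no terminal limit of a singular run is locally two-dimensional. The implication from
Ladyzhenskaya's 2D theorem (smooth 2D data) to this statement about blow-up limits is not printed.
[claim: Shahmurov2026TwoPart, status: under-review] -/
def Step_II_twoD : Prop :=
  ∀ (u : ℝ → E3 → E3) (p : ℝ → E3 → ℝ) (T : ℝ), IsSingularRun u p T →
    ∀ v : ℝ → E3 → E3, IsTerminalLimit u p T v → ¬ IsLocallyTwoDimensional v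

/-- **Step II (handoff to Part I), «implicit»** (§11 proof l.1337, p.24: "The axisymmetric alternative is
regular by Theorem 1.1"; §20 l.1870, p.34: "An axisymmetric-with-swirl branch is smooth by Theorem 1.1"; §21
p.34: "The only handoff from Part II to Part I is the exact axisymmetric-with-swirl class obtained in Lemma
18.3"): Main Thm 1.1 — a statement about smooth solutions from `C_c^∞` axisymmetric DATA — is asserted to
exclude an axisymmetric TERMINAL LIMIT (a normalized blow-up limit on `Q₂`) of a singular run. The implication
is not printed; it is typed as its own step. [claim: Shahmurov2026TwoPart, status: under-review] -/
def Step_II_handoff : Prop :=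
  ClaimedTheoremAxisym →
    ∀ (u : ℝ → E3 → E3) (p : ℝ → E3 → ℝ) (T : ℝ), IsSingularRun u p T →
      ∀ v : ℝ → E3 → E3, IsTerminalLimit u p T v → ¬ IsAxisymmetricBranch v

/-- **Main Theorem 1.2 / 11.1 from Main Theorem 1.1 and the Part II steps** (proof of Main Thm 11.1 p.24 and
§20 p.33–34, re-run in the kernel): a non-extendable run is a singular run; its terminal limit is locally 2D
or axisymmetric; both are excluded. Pure logic. [cite: Shahmurov2026TwoPart, §20 p.33–34] -/
theorem claimedTheorem_of_partII (hI : ClaimedTheoremAxisym) (hfe : Step_II_frontEnd)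
    (h2d : Step_II_twoD) (hho : Step_II_handoff) : ClaimedTheorem := by
  intro u₀ hu₀ hcs hdiv T hT u p hsol h0 hLH
  by_contra hne
  subst h0
  have hrun : IsSingularRun u p T := ⟨hT, ⟨hsol, hne⟩, hu₀, hcs, hdiv, hLH⟩
  obtain ⟨v, hv, h2 | hax⟩ := hfe u p T hrun
  · exact h2d u p T hrun v hv h2
  · exact hho hI u p T hrun v hv hax

/-! ## F. Composition -/

/-- **COMPOSITION** (the paper's logic composes): for the paper's Part I bookkeeping `K`, the typed steps —
Step I-5.1 (Prop 5.1 + Thm 5.4 proof opening, p.14–15), Prop 5.2 (p.14–15), Prop 5.3 (p.15; on the printed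
path, NOT consumed: Prop 5.2 alone excludes the saturator, `noSaturatingProfile_of_prop52`), Step I-6.2
(Props 3.3, 4.2, 5.5, 6.1, 6.2, 8.4), Step I-9.1 (Props 7.5, 9.1), and the Part II front end (Lemma 13.1 …
Thm 19.1), 2D closure and handoff (§11, §20) — imply Main Theorem 1.2. Pure logic
(`claimedTheoremAxisym_of_steps`, `claimedTheorem_of_partII`). [claim: Shahmurov2026TwoPart, status: under-review] -/
theorem claim_of_steps (K : TerminalBookkeeping) (h51 : Step_I51 K) (h52 : Prop52) (_h53 : Prop53)
    (h62 : Step_I62 K) (h91 : Step_I91 K) (hfe : Step_II_frontEnd) (h2d : Step_II_twoD)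
    (hho : Step_II_handoff) : ClaimedTheorem :=
  claimedTheorem_of_partII (claimedTheoremAxisym_of_steps K h51 h52 h62 h91) hfe h2d hho

end

end Literature.Claims.NS.Shahmurov2026
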